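import Literature.AnabelianGeometry.AbsoluteAnabelian.AbsTopIII.Thm19Evaluation
import HarnessLib

/-!
# [AbsTopIII] Thm. 1.9 (e): the extracted Prop.-1.3 triple IS the function-field triple — assembly of
# `Thm19e` modulo the levelwise dictionary (proof-only)

Mochizuki, *Topics in Absolute Anabelian Geometry III*, §1, Theorem 1.9 (e), manuscript p. 38 (lit key
`paper:url-5493eb38cbb7`): "One constructs the additive structure on `k̄_NF^× ∪ {0}`; `K_{Z_NF}^× ∪ {0}`
[...] by applying the functorial algorithm of Proposition 1.3 to the data of the form described in
Proposition 1.3, (a), (b), (c), arising from the construction of (d) [cf. also the decomposition groups of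
(a), the isomorphisms of (b)]."

Proof-only companion of `Thm19Evaluation.lean` (abc-iut-w5-d213, p416240); sub-DAG
`plan/L4/SUBDAG-AbsTopIII-Thm19.md`, row Thm19.e.r11 (cell abc-iut; GAP-LEDGER G-w5d213-3).  The NAMED
statement `IntrinsicKummerModel.Thm19e` asserts that the triple `evaluationTriple S` extracted from the
Kummer container (group generated by "`K_{Z_NF}^×`", NF-points of the levels modulo `SamePoint`, orders via
THE (b)-synchronizations, value-one subgroups via restriction to decomposition groups) is ISOMORPHIC, as a
Prop.-1.3 triple, to the triple of a genuine function field `K ≅ K_{Z_NF}` over `k ≅ k̄_NF`.  THIS FILE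
proves it — the ASSEMBLY: the group isomorphism `φ` from the embedding "`K_{Z_NF}^× ↪ lim`" of (d), the
bijection `σ : PointIndex S ≃ X(k)` by descending the point dictionary along `SamePoint`, the Prop.-1.3
compatibilities `ord ∘ φ = ord`, `U ↦ U` — from the LEVELWISE DICTIONARY as ONE explicit hypothesis in
consumed form (interface identifications, true at the intended étale-`π₁` model, not derivable from
`CurveModel`; GAP-LEDGER G-w5d213-3 (e0)–(e3); the abc-iut-L4-t1 lineage's per-curve laws (D)(E) and the
base-change legs are to DERIVE (e2)(e3), the tower of abc-iut-w5-d213's `NFTower` the embedding and (e1)):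

* (e0) `K_{Z_NF} = M.NFFunctionField Z` is an algebraic function field of one variable of genus `≥ 2` over
  `k̄_NF = M.kbarNF Z` (which IS algebraically closed: Mathlib's relative algebraic closure of `ℚ` in `k̄`);
* the embedding `e : K_{Z_NF}^× ↪ lim` with image "`K_{Z_NF}^×`" (`functionFieldPart`; landed for towers:
  `NFTower.exists_functionFieldEmbedding` + `functionFieldPart_eq_nfRationalImage`);
* (e1) the point dictionary `π : NFPointIndex S → X(k̄_NF)` (places of `K_{Z_NF}/k̄_NF`) with
  "`SamePoint` ⟺ same place" and surjectivity;
* (e2) the order dictionary `HasOrderAt (e f) a n ⟺ ord_{π a} f = n` (Prop. 1.6 (iii)'s degree clause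
  through the synchronization);
* (e3) the value dictionary `HasValueOneAt (e f) a ⟺ f(π a) = 1` (Prop. 1.8's evaluation `η|_x := s_x^* η`
  and Kummer-faithfulness).

Closer: `thm19e_of_dictionary : (dictionary per directed system) → M.Thm19e`.  No definition, no new named
fact.  HONEST FRAMING: typed ≠ proved for the dictionary; nothing here bears on [IUTchIII] Cor. 3.12.
-/

noncomputable section

open CategoryTheory
open scoped Classical

namespace Literature.AnabelianGeometry.AbsoluteAnabelian.AbsTopIII

open Literature.NumberTheory.DiophantineGeometry
open Literature.NumberTheory.DiophantineGeometry.AlgFunctionField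

universe u

namespace IntrinsicKummerModel

variable (M : IntrinsicKummerModel.{u}) {Z : M.Curve} {ι : Type u} [Preorder ι]
  (S : CurveModel.NFComplementSystem M.toCurveModel Z ι)

/-- `k̄_NF` (the algebraic closure of `ℚ` in `k̄_Z`) is algebraically closed.
[cite: MochizukiAbsTopIII2015, Def 1.7 p.35] -/
theorem isAlgClosed_kbarNF (Z : M.Curve) : IsAlgClosed ↥(M.kbarNF Z) :=
  (algebraicClosure.isAlgClosure ℚ (AlgebraicClosure (M.base Z))).isAlgClosed

/-- **The Prop.-1.3 triple extracted from the container is isomorphic to the function-field triple**,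
for one directed system, GIVEN: a `k̄_NF`-algebra structure on `K_{Z_NF}`; an injective embedding
`e : K_{Z_NF}^× → lim` with image `functionFieldPart S`; the point dictionary `π` (descending `SamePoint`,
surjective); the order dictionary and the value dictionary along `e` and `π`.
[cite: MochizukiAbsTopIII2015, Thm 1.9 (e) p.38] -/
theorem exists_isIso_evaluationTriple [Algebra ↥(M.kbarNF Z) (M.NFFunctionField Z)]
    (e : Additive (M.NFFunctionField Z)ˣ →+ S.kummerContainer) (he : Function.Injective e)
    (hrange : Set.range e = M.functionFieldPart S)
    (π : M.NFPointIndex S → PlaceOver ↥(M.kbarNF Z) (M.NFFunctionField Z))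
    (hπ : ∀ a b, M.SamePoint S a b ↔ π a = π b) (hπs : Function.Surjective π)
    (hord : ∀ (f : (M.NFFunctionField Z)ˣ) (a : M.NFPointIndex S) (n : ℤ),
      M.HasOrderAt S (e (Additive.ofMul f)) a n ↔ (π a).ord (f : M.NFFunctionField Z) = n)
    (hval : ∀ (f : (M.NFFunctionField Z)ˣ) (a : M.NFPointIndex S),
      M.HasValueOneAt S (e (Additive.ofMul f)) a ↔ f ∈ unitsWithValueOne (π a)) :
    ∃ (φ : (M.evaluationTriple S).G ≃* (valuationEvaluationData ↥(M.kbarNF Z) (M.NFFunctionField Z)).G)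
      (σ : (M.evaluationTriple S).I ≃ (valuationEvaluationData ↥(M.kbarNF Z) (M.NFFunctionField Z)).I),
      (M.evaluationTriple S).IsIso (valuationEvaluationData ↥(M.kbarNF Z) (M.NFFunctionField Z)) φ σ := by
  classical
  -- (a) the group: `closure (functionFieldPart S) = range e ≅ K_{Z_NF}^×`
  have hcl : AddSubgroup.closure (M.functionFieldPart S) = e.range := by
    rw [← hrange, ← AddMonoidHom.coe_range, AddSubgroup.closure_eq]
  let ψ : ↥(AddSubgroup.closure (M.functionFieldPart S)) ≃+ Additive (M.NFFunctionField Z)ˣ :=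
    (AddEquiv.addSubgroupCongr hcl).trans (AddMonoidHom.ofInjective he).symm
  have hψ : ∀ x : ↥(AddSubgroup.closure (M.functionFieldPart S)), e (ψ x) = (x : S.kummerContainer) := by
    intro x
    change e ((AddMonoidHom.ofInjective he).symm (AddEquiv.addSubgroupCongr hcl x)) = _
    rw [AddMonoidHom.apply_ofInjective_symm he]
    rfl
  let φ : (M.evaluationTriple S).G ≃* (M.NFFunctionField Z)ˣ := AddEquiv.toMultiplicativeLeft ψ
  have hφ : ∀ ξ : (M.evaluationTriple S).G,
      e (Additive.ofMul (φ ξ)) =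
        ((Multiplicative.toAdd ξ : ↥(AddSubgroup.closure (M.functionFieldPart S))) : S.kummerContainer) :=
    fun ξ => hψ (Multiplicative.toAdd ξ)
  -- (b) the index set: descend `π` along `SamePoint`
  let σ₀ : M.PointIndex S → PlaceOver ↥(M.kbarNF Z) (M.NFFunctionField Z) :=
    Quot.lift π fun a b h => (hπ a b).1 h
  have hσ₀ : ∀ a, σ₀ (Quot.mk _ a) = π a := fun a => rfl
  have hσinj : Function.Injective σ₀ := by
    intro q q'
    induction q using Quot.ind
    induction q' using Quot.ind
    intro h
    exact Quot.sound ((hπ _ _).2 h)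
  have hσsurj : Function.Surjective σ₀ := fun v => by
    obtain ⟨a, ha⟩ := hπs v
    exact ⟨Quot.mk _ a, ha⟩
  let σ : (M.evaluationTriple S).I ≃ PlaceOver ↥(M.kbarNF Z) (M.NFFunctionField Z) :=
    Equiv.ofBijective σ₀ ⟨hσinj, hσsurj⟩
  have hσout : ∀ q : M.PointIndex S, σ q = π (Quot.out q) := fun q => by
    change σ₀ q = _
    conv_lhs => rw [← Quot.out_eq q]
  refine ⟨φ, σ, ⟨fun q ξ => ?_, fun q => ?_⟩⟩
  · -- ord ∘ φ = ord
    change (σ q).ord ((φ ξ : (M.NFFunctionField Z)ˣ) : M.NFFunctionField Z) =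
      M.orderAt S (Quot.out q)
        ((Multiplicative.toAdd ξ : ↥(AddSubgroup.closure (M.functionFieldPart S))) : S.kummerContainer)
    rw [hσout, ← hφ ξ]
    have hex : ∃ n : ℤ, M.HasOrderAt S (e (Additive.ofMul (φ ξ))) (Quot.out q) n :=
      ⟨_, (hord (φ ξ) (Quot.out q) _).2 rfl⟩
    unfold orderAt
    rw [dif_pos hex]
    exact (hord (φ ξ) (Quot.out q) _).1 hex.choose_spec
  · -- U ↦ U
    change unitsWithValueOne (σ q) =
      (Subgroup.closure {ξ : (M.evaluationTriple S).G | M.HasValueOneAt S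
        ((Multiplicative.toAdd ξ : ↥(AddSubgroup.closure (M.functionFieldPart S))) : S.kummerContainer)
        (Quot.out q)}).map φ.toMonoidHom
    rw [MonoidHom.map_closure, hσout]
    have hset : (φ.toMonoidHom : (M.evaluationTriple S).G → (M.NFFunctionField Z)ˣ) ''
        {ξ : (M.evaluationTriple S).G | M.HasValueOneAt S
          ((Multiplicative.toAdd ξ : ↥(AddSubgroup.closure (M.functionFieldPart S))) :
            S.kummerContainer) (Quot.out q)} =
        (unitsWithValueOne (π (Quot.out q)) : Set (M.NFFunctionField Z)ˣ) := by
      ext f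
      constructor
      · rintro ⟨ξ, hξ, rfl⟩
        have hξ' : M.HasValueOneAt S (e (Additive.ofMul (φ ξ))) (Quot.out q) := by rwa [hφ ξ]
        exact (hval (φ ξ) (Quot.out q)).1 hξ'
      · intro hf
        refine ⟨φ.symm f, ?_, φ.apply_symm_apply f⟩
        change M.HasValueOneAt S _ (Quot.out q)
        rw [← hφ (φ.symm f), φ.apply_symm_apply]
        exact (hval f (Quot.out q)).2 hf
    rw [hset, Subgroup.closure_eq]

/-- **Thm. 1.9 (e) modulo the levelwise dictionary**: the NAMED statement `Thm19e` from ONE explicit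
hypothesis carrying, per (d)-input `Z` and directed system `S`: (e0) a `k̄_NF`-algebra structure making
`K_{Z_NF}` an algebraic function field of one variable of genus `≥ 2`; the embedding `K_{Z_NF}^× ↪ lim` with
image "`K_{Z_NF}^×"` (for towers: `NFTower.exists_functionFieldEmbedding` with
`NFTower.functionFieldPart_eq_nfRationalImage`); (e1) the point dictionary; (e2) the order dictionary;
(e3) the value dictionary (cell GAP-LEDGER G-w5d213-3, exact shapes = the binders; to be DERIVED from the
abc-iut-L4-t1 lineage's per-curve laws (D)(E) and base-change legs).  `k̄_NF` is algebraically closed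
(PROVED, `isAlgClosed_kbarNF`); `k`, `K` of `Thm19e` are taken to be `k̄_NF`, `K_{Z_NF}` themselves.
[cite: MochizukiAbsTopIII2015, Thm 1.9 (e) p.38] -/
theorem thm19e_of_dictionary
    (hdict : ∀ (Z : M.Curve), M.IsThm19dInput Z → ∀ (ι : Type u) [Preorder ι] [Nonempty ι]
      [IsDirectedOrder ι] (S : CurveModel.NFComplementSystem M.toCurveModel Z ι),
      ∃ (_ : Algebra ↥(M.kbarNF Z) (M.NFFunctionField Z))
        (_ : IsAlgFunctionField ↥(M.kbarNF Z) (M.NFFunctionField Z)),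
        2 ≤ genus ↥(M.kbarNF Z) (M.NFFunctionField Z) ∧
        ∃ (e : Additive (M.NFFunctionField Z)ˣ →+ S.kummerContainer)
          (π : M.NFPointIndex S → PlaceOver ↥(M.kbarNF Z) (M.NFFunctionField Z)),
          Function.Injective e ∧ Set.range e = M.functionFieldPart S ∧
          (∀ a b, M.SamePoint S a b ↔ π a = π b) ∧ Function.Surjective π ∧
          (∀ (f : (M.NFFunctionField Z)ˣ) (a : M.NFPointIndex S) (n : ℤ),
            M.HasOrderAt S (e (Additive.ofMul f)) a n ↔ (π a).ord (f : M.NFFunctionField Z) = n) ∧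
          (∀ (f : (M.NFFunctionField Z)ˣ) (a : M.NFPointIndex S),
            M.HasValueOneAt S (e (Additive.ofMul f)) a ↔ f ∈ unitsWithValueOne (π a))) :
    M.Thm19e := by
  intro Z hZ ι _ _ _ S
  obtain ⟨_, _, hg, e, π, he, hrange, hπ, hπs, hord, hval⟩ := hdict Z hZ ι S
  obtain ⟨φ, σ, hiso⟩ := M.exists_isIso_evaluationTriple S e he hrange π hπ hπs hord hval
  exact ⟨↥(M.kbarNF Z), M.NFFunctionField Z, inferInstance, inferInstance, inferInstance,
    M.isAlgClosed_kbarNF Z, inferInstance, hg, ⟨RingEquiv.refl _⟩, ⟨RingEquiv.refl _⟩, φ, σ, hiso⟩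

end IntrinsicKummerModel

end Literature.AnabelianGeometry.AbsoluteAnabelian.AbsTopIII
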